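import Literature.AnabelianGeometry.SemiGraphs.BTempQDPairHomHat
import Literature.AnabelianGeometry.SemiGraphs.BTempPullbackOrbit
import HarnessLib

/-!
# Semi-graphs of anabelioids, Appendix, proof of Theorem A.4: the common refinement `(B⁗, Γ_B⁗)` of
# two 1-proper covers of a QD-pair of `B^temp(Π)` — construction and lifting clauses (part 1 of 2)

Mochizuki, *Semi-graphs of anabelioids*, Publ. RIMS **42** (2006) 221–322, Appendix, proof of
Theorem A.4, manuscript p. 84 (PRIMS p. 314 ll. 1–8) [cite: MochizukiSemiAnbd2006, Thm A.4 proof p.84]: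
"Now one verifies easily that any two 1-proper morphisms of strongly connected QD-pairs
`(B″, Γ_B″) → (B, Γ_B)`, `(B‴, Γ_B‴) → (B, Γ_B)` fit into a commutative diagram of 1-proper
morphisms of strongly connected QD-pairs of `D_i`
  `(B⁗, Γ_B⁗) → (B″, Γ_B″)`, `(B⁗, Γ_B⁗) → (B‴, Γ_B‴)` [over `(B, Γ_B)`].
Thus … `Hom^((B, Γ_B), (C, Γ_C)) := lim_→ Hom̄((B′, Γ_B′), (C, Γ_C))` [is a] filtered inductive limit".

Row **A4-S-dir** of the abc-iut cell's `plan/L3/SUBDAG-SemiAnbd-Cor311.md` (holder abc-iut-w5-d129;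
this file by wave-4 seat abc-iut-w4-d081), PART 1: the CONSTRUCTION behind the named statement
`QDPair.OneProperCoversDirected P` of `BTempQDPairHomHat.lean` (abc-iut-w5-d129) for a QD-pair
`P = (B, Γ_B)` of the model temperoid `B^temp(Π)` (`Π` any topological group), on points, with the
explicit fibre products and orbit sub-objects of `BTempPullbackOrbit.lean` (abc-iut-w5-d129); the
quotient clauses, 1-properness and the theorem itself are part 2 (`BTempQDPairCoversDirected.lean`):

* `B⁗ :=` the `Π`-orbit of `(b″, b‴)` in `B″ ×_{B/Γ_B} B‴`, where `b″ ∈ B″`, `b‴ ∈ B‴` lie over one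
  point `b ∈ B` (the fibre product is taken over `B/Γ_B`, so that EVERY pair `(γ″, γ‴) ∈ Γ_B″ × Γ_B‴`
  acts on it — `QDPair.OneProperCover.pairAut`);
* `Γ_B⁗ :=` the pairs `(γ″, γ‴)` stabilising that orbit, restricted to it (`coverGroup`);
* the two projections `t : (B⁗, Γ_B⁗) → (B″, Γ_B″)`, `t′ : (B⁗, Γ_B⁗) → (B‴, Γ_B‴)` and the composite
  `(B⁗, Γ_B⁗) → (B, Γ_B)`; their LIFTING clauses ("`Γ_B⁗ → Γ_B″` surjective": given `γ″`, transport
  `γ″ b″ = a · b″` to the `B‴` side and correct the chosen lift `γ‴` of the common image `γ_B ∈ Γ_B`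
  by an element of `Ker(Γ_B‴ → Γ_B)`, which acts transitively on the fibres of `B‴ → B` —
  `QDPair.IsQuotient.apply_eq_iff`, `BTempQDPairQuotients.lean`).

Elementary `Π`-set theory; nothing refers to the IUT corpus and no side is taken on any disputed claim.
-/

open CategoryTheory

namespace Literature.AnabelianGeometry.SemiGraphs

open Literature.AlgebraicGeometry.Frobenioids (IsConnectedObj)
open Literature.AlgebraicGeometry.Frobenioids.QuasiTemperoid.BTempConnected (hom_ρ hom_ext_apply
  ρ_one_apply ρ_mul_apply ρ_inv_apply exists_ρ_eq_of_isConnectedObj nonempty_of_isConnectedObj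
  hom_eq_of_apply_eq isConnectedObj_of_transitive)

universe u

namespace QDPair

namespace OneProperCover

variable {G : Type u} [Group G] [TopologicalSpace G] [IsTopologicalGroup G]
variable {P : QDPair (BTemp G)} (c c' : OneProperCover P)

/-! ### Points: a 1-proper cover is surjective; base points `b″ ↦ b ↤ b‴` -/

/-- The arrow of a 1-proper cover is surjective on points (its quotient clause).
[cite: MochizukiSemiAnbd2006, Def A.3(iv) p.82] -/
theorem hom_surjective :
    Function.Surjective fun x : c.src.A.obj.V => (c.hom.hom.hom.hom x : P.A.obj.V) :=
  IsQuotient.surjective (P := (⟨c.src.A, Hom.stabilizer c.hom⟩ : QDPair (BTemp G))) c.isOneProper.2.2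

/-- Two points of `B″` with the same image in `B` differ by an element of `Ker(Γ_B″ → Γ_B)` (the
quotient clause of 1-properness, on points). [cite: MochizukiSemiAnbd2006, Def A.3(iv) p.82] -/
theorem exists_stabilizer_apply_eq {x y : c.src.A.obj.V}
    (h : (c.hom.hom.hom.hom x : P.A.obj.V) = c.hom.hom.hom.hom y) :
    ∃ k ∈ Hom.stabilizer c.hom, (k.hom.hom.hom x : c.src.A.obj.V) = y :=
  (IsQuotient.apply_eq_iff (P := (⟨c.src.A, Hom.stabilizer c.hom⟩ : QDPair (BTemp G)))
    c.isOneProper.2.2).mp h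

include c in
/-- The target of a 1-proper cover (by a strongly connected pair) is connected.
[cite: MochizukiSemiAnbd2006, Thm A.4 proof p.84] -/
theorem isConnectedObj_target : IsConnectedObj P.A := by
  obtain ⟨x₀⟩ := nonempty_of_isConnectedObj c.src.A c.isStronglyConnected
  refine isConnectedObj_of_transitive P.A (c.hom.hom.hom.hom x₀) fun x => ?_
  obtain ⟨y, rfl⟩ := c.hom_surjective x
  obtain ⟨a, rfl⟩ := exists_ρ_eq_of_isConnectedObj c.src.A c.isStronglyConnected x₀ y
  exact ⟨a, (hom_ρ c.hom.hom a x₀).symm⟩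

/-- A base point `b″ ∈ B″`. [cite: MochizukiSemiAnbd2006, Thm A.4 proof p.84] -/
noncomputable def pt₁ : c.src.A.obj.V :=
  (nonempty_of_isConnectedObj c.src.A c.isStronglyConnected).some

/-- A base point `b‴ ∈ B‴` over the same point `b ∈ B` as `b″`. [cite: MochizukiSemiAnbd2006, Thm A.4 proof p.84] -/
noncomputable def pt₂ : c'.src.A.obj.V :=
  (c'.hom_surjective (c.hom.hom.hom.hom (pt₁ c) : P.A.obj.V)).choose

/-- `b‴ ↦ b`. [cite: MochizukiSemiAnbd2006, Thm A.4 proof p.84] -/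
theorem pt₂_spec :
    (c'.hom.hom.hom.hom (pt₂ c c') : P.A.obj.V) = c.hom.hom.hom.hom (pt₁ c) :=
  (c'.hom_surjective (c.hom.hom.hom.hom (pt₁ c) : P.A.obj.V)).choose_spec

/-! ### The ambient fibre product `B″ ×_{B/Γ_B} B‴` and the pairs `(γ″, γ‴)` acting on it -/

/-- Elements of `Γ_B″` lie over `B/Γ_B`: `γ″ ≫ (B″ → B → B/Γ_B) = (B″ → B → B/Γ_B)`.
[cite: MochizukiSemiAnbd2006, Thm A.4 proof p.84] -/
theorem aut_comp_leg {γ : Aut c.src.A} (hγ : γ ∈ c.src.Γ) :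
    γ.hom ≫ (c.hom.hom ≫ P.orbitQuotientπ) = c.hom.hom ≫ P.orbitQuotientπ := by
  obtain ⟨δ, hδ, hcomm⟩ := c.hom.comm γ hγ
  rw [← Category.assoc, ← hcomm, Category.assoc, P.aut_comp_orbitQuotientπ hδ]

/-- The ambient fibre product `B″ ×_{B/Γ_B} B‴`. [cite: MochizukiSemiAnbd2006, Thm A.4 proof p.84] -/
def amb : BTemp G :=
  BTemp.pullbackObj (c.hom.hom ≫ P.orbitQuotientπ) (c'.hom.hom ≫ P.orbitQuotientπ)

/-- The base point `(b″, b‴)` of the ambient fibre product. [cite: MochizukiSemiAnbd2006, Thm A.4 proof p.84] -/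
noncomputable def basePt : (amb c c').obj.V :=
  BTemp.pullbackPt _ _ (pt₁ c) (pt₂ c c') (by
    change P.orbitMk (c.hom.hom.hom.hom (pt₁ c)) = P.orbitMk (c'.hom.hom.hom.hom (pt₂ c c'))
    rw [pt₂_spec])

/-- **The pairs `(γ″, γ‴) ∈ Γ_B″ × Γ_B‴` acting on `B″ ×_{B/Γ_B} B‴`**, as a homomorphism
`Γ_B″ × Γ_B‴ → Aut(B″ ×_{B/Γ_B} B‴)`. [cite: MochizukiSemiAnbd2006, Thm A.4 proof p.84] -/
noncomputable def pairAut : c.src.Γ × c'.src.Γ →* Aut (amb c c') where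
  toFun x := BTemp.pullbackAut _ _ (x.1 : Aut c.src.A) (x.2 : Aut c'.src.A)
    (aut_comp_leg c x.1.2) (aut_comp_leg c' x.2.2)
  map_one' := Iso.ext (hom_ext_apply fun _ => rfl)
  map_mul' _ _ := Iso.ext (hom_ext_apply fun _ => rfl)

/-- `(γ″, γ‴)` on points. [cite: MochizukiSemiAnbd2006, Thm A.4 proof p.84] -/
@[simp] theorem pairAut_apply_val (x : c.src.Γ × c'.src.Γ) (p : (amb c c').obj.V) :
    ((pairAut c c' x).hom.hom.hom p).1 =
      ((x.1 : Aut c.src.A).hom.hom.hom p.1.1, (x.2 : Aut c'.src.A).hom.hom.hom p.1.2) := rfl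

/-! ### `B⁗` and `Γ_B⁗` -/

/-- **`B⁗`**: the `Π`-orbit of `(b″, b‴)` in `B″ ×_{B/Γ_B} B‴` — a connected object.
[cite: MochizukiSemiAnbd2006, Thm A.4 proof p.84] -/
noncomputable def coverObj : BTemp G := BTemp.orbitObj (amb c c') (basePt c c')

/-- `B⁗` is connected. [cite: MochizukiSemiAnbd2006, Thm A.4 proof p.84] -/
theorem coverObj_isConnectedObj : IsConnectedObj (coverObj c c') :=
  BTemp.orbitObj_isConnectedObj _ _

/-- The pairs `(γ″, γ‴)` stabilising the orbit `B⁗`, as a subgroup of the orbit stabiliser.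
[cite: MochizukiSemiAnbd2006, Thm A.4 proof p.84] -/
noncomputable def pairStab : Subgroup (BTemp.stabOrbit (amb c c') (basePt c c')) :=
  (pairAut c c').range.comap (BTemp.stabOrbit (amb c c') (basePt c c')).subtype

/-- **`Γ_B⁗`**: the pairs `(γ″, γ‴)` stabilising `B⁗`, restricted to `B⁗`.
[cite: MochizukiSemiAnbd2006, Thm A.4 proof p.84] -/
noncomputable def coverGroup : Subgroup (Aut (coverObj c c')) :=
  (pairStab c c').map (BTemp.restrictOrbit (amb c c') (basePt c c'))

/-- **`(B⁗, Γ_B⁗)`**. [cite: MochizukiSemiAnbd2006, Thm A.4 proof p.84] -/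
noncomputable def coverPair : QDPair (BTemp G) := ⟨coverObj c c', coverGroup c c'⟩

/-- Membership in `Γ_B⁗`, unpacked: the restriction of a pair `(γ″, γ‴)` stabilising the orbit.
[cite: MochizukiSemiAnbd2006, Thm A.4 proof p.84] -/
theorem mem_coverGroup_iff {g : Aut (coverObj c c')} :
    g ∈ coverGroup c c' ↔ ∃ (x : c.src.Γ × c'.src.Γ)
      (hx : pairAut c c' x ∈ BTemp.stabOrbit (amb c c') (basePt c c')),
      BTemp.restrictOrbit _ _ ⟨pairAut c c' x, hx⟩ = g := by
  constructor
  · rintro ⟨σ, hσ, rfl⟩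
    obtain ⟨x, hx⟩ := Subgroup.mem_comap.mp hσ
    refine ⟨x, by rw [hx]; exact σ.2, ?_⟩
    congr 1
    exact Subtype.ext hx
  · rintro ⟨x, hx, rfl⟩
    exact Subgroup.mem_map.mpr ⟨⟨pairAut c c' x, hx⟩, Subgroup.mem_comap.mpr ⟨x, rfl⟩, rfl⟩

/-- Restrictions of orbit-stabilising pairs lie in `Γ_B⁗`. [cite: MochizukiSemiAnbd2006, Thm A.4 proof p.84] -/
theorem restrictOrbit_mem_coverGroup (x : c.src.Γ × c'.src.Γ)
    (hx : pairAut c c' x ∈ BTemp.stabOrbit (amb c c') (basePt c c')) :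
    BTemp.restrictOrbit _ _ ⟨pairAut c c' x, hx⟩ ∈ coverGroup c c' :=
  (mem_coverGroup_iff c c').mpr ⟨x, hx, rfl⟩

/-- A pair `(γ″, γ‴)` moving `(b″, b‴)` to `a · (b″, b‴)` stabilises the orbit.
[cite: MochizukiSemiAnbd2006, Thm A.4 proof p.84] -/
theorem pairAut_mem_stabOrbit {x : c.src.Γ × c'.src.Γ} {a : G}
    (h₁ : ((x.1 : Aut c.src.A).hom.hom.hom (pt₁ c) : c.src.A.obj.V) = c.src.A.obj.ρ a (pt₁ c))
    (h₂ : ((x.2 : Aut c'.src.A).hom.hom.hom (pt₂ c c') : c'.src.A.obj.V) =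
      c'.src.A.obj.ρ a (pt₂ c c')) :
    pairAut c c' x ∈ BTemp.stabOrbit (amb c c') (basePt c c') :=
  ⟨a, BTemp.pullbackObj_ext _ _ h₁.symm h₂.symm⟩

/-! ### The two projections and the composite to `(B, Γ_B)` -/

/-- The arrow `B⁗ → B″`. [cite: MochizukiSemiAnbd2006, Thm A.4 proof p.84] -/
noncomputable def fstArrow : coverObj c c' ⟶ c.src.A :=
  BTemp.orbitIncl _ _ ≫ BTemp.pullbackFst _ _

/-- The arrow `B⁗ → B‴`. [cite: MochizukiSemiAnbd2006, Thm A.4 proof p.84] -/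
noncomputable def sndArrow : coverObj c c' ⟶ c'.src.A :=
  BTemp.orbitIncl _ _ ≫ BTemp.pullbackSnd _ _

/-- `B⁗ → B″` on points. [cite: MochizukiSemiAnbd2006, Thm A.4 proof p.84] -/
@[simp] theorem fstArrow_apply (z : (coverObj c c').obj.V) :
    ((fstArrow c c').hom.hom z : c.src.A.obj.V) = z.1.1.1 := rfl

/-- `B⁗ → B‴` on points. [cite: MochizukiSemiAnbd2006, Thm A.4 proof p.84] -/
@[simp] theorem sndArrow_apply (z : (coverObj c c').obj.V) :
    ((sndArrow c c').hom.hom z : c'.src.A.obj.V) = z.1.1.2 := rfl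

/-- An element of `Γ_B⁗` given by the pair `(γ″, γ‴)` acts through `γ″` after `B⁗ → B″` and through
`γ‴` after `B⁗ → B‴`. [cite: MochizukiSemiAnbd2006, Thm A.4 proof p.84] -/
theorem restrictOrbit_fst (x : c.src.Γ × c'.src.Γ)
    (hx : pairAut c c' x ∈ BTemp.stabOrbit (amb c c') (basePt c c')) :
    (BTemp.restrictOrbit _ _ ⟨pairAut c c' x, hx⟩).hom ≫ fstArrow c c' =
      fstArrow c c' ≫ (x.1 : Aut c.src.A).hom :=
  hom_ext_apply fun _ => rfl

/-- Idem for the second projection. [cite: MochizukiSemiAnbd2006, Thm A.4 proof p.84] -/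
theorem restrictOrbit_snd (x : c.src.Γ × c'.src.Γ)
    (hx : pairAut c c' x ∈ BTemp.stabOrbit (amb c c') (basePt c c')) :
    (BTemp.restrictOrbit _ _ ⟨pairAut c c' x, hx⟩).hom ≫ sndArrow c c' =
      sndArrow c c' ≫ (x.2 : Aut c'.src.A).hom :=
  hom_ext_apply fun _ => rfl

/-- **`t : (B⁗, Γ_B⁗) → (B″, Γ_B″)`**, a morphism of QD-pairs. [cite: MochizukiSemiAnbd2006, Thm A.4 proof p.84] -/
noncomputable def fst : coverPair c c' ⟶ c.src where
  hom := fstArrow c c'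
  comm := by
    intro g hg
    obtain ⟨x, hx, rfl⟩ := (mem_coverGroup_iff c c').mp hg
    exact ⟨x.1, x.1.2, (restrictOrbit_fst c c' x hx).symm⟩

/-- **`t′ : (B⁗, Γ_B⁗) → (B‴, Γ_B‴)`**, a morphism of QD-pairs. [cite: MochizukiSemiAnbd2006, Thm A.4 proof p.84] -/
noncomputable def snd : coverPair c c' ⟶ c'.src where
  hom := sndArrow c c'
  comm := by
    intro g hg
    obtain ⟨x, hx, rfl⟩ := (mem_coverGroup_iff c c').mp hg
    exact ⟨x.2, x.2.2, (restrictOrbit_snd c c' x hx).symm⟩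

/-- The square commutes ON THE ORBIT: `t′ ≫ (B‴ → B) = t ≫ (B″ → B)` (both are `Π`-maps out of the
connected `B⁗` agreeing at `(b″, b‴)`). [cite: MochizukiSemiAnbd2006, Thm A.4 proof p.84] -/
theorem snd_comp_eq_fst_comp : snd c c' ≫ c'.hom = fst c c' ≫ c.hom := by
  apply Hom.ext
  change sndArrow c c' ≫ c'.hom.hom = fstArrow c c' ≫ c.hom.hom
  refine hom_eq_of_apply_eq (coverObj_isConnectedObj c c') _ _ (BTemp.orbitPt _ _) ?_
  change (c'.hom.hom.hom.hom (pt₂ c c') : P.A.obj.V) = c.hom.hom.hom.hom (pt₁ c)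
  exact pt₂_spec c c'

/-! ### Points of `B⁗` -/

/-- Every point of `B⁗` is a translate of the base point. [cite: MochizukiSemiAnbd2006, Thm A.4 proof p.84] -/
theorem exists_ρ_orbitPt (z : (coverObj c c').obj.V) :
    ∃ a : G, (coverObj c c').obj.ρ a (BTemp.orbitPt _ _) = z :=
  BTemp.orbitObj_transitive _ _ z

/-- The translate `a · (b″, b‴)` has components `(a · b″, a · b‴)`. [cite: MochizukiSemiAnbd2006, Thm A.4 proof p.84] -/
theorem ρ_orbitPt_val (a : G) :
    ((coverObj c c').obj.ρ a (BTemp.orbitPt (amb c c') (basePt c c'))).1.1 =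
      (c.src.A.obj.ρ a (pt₁ c), c'.src.A.obj.ρ a (pt₂ c c')) := rfl

/-- `b″` and `b‴` lie over the same `b`, and so do their translates. [cite: MochizukiSemiAnbd2006, Thm A.4 proof p.84] -/
theorem hom_ρ_pt₂ (a : G) :
    (c'.hom.hom.hom.hom (c'.src.A.obj.ρ a (pt₂ c c')) : P.A.obj.V) =
      c.hom.hom.hom.hom (c.src.A.obj.ρ a (pt₁ c)) := by
  rw [hom_ρ, hom_ρ, pt₂_spec]

/-! ### The core: correcting a lift by `Ker(Γ_B‴ → Γ_B)` (resp. `Ker(Γ_B″ → Γ_B)`) -/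

/-- **Core construction, first form.** Given `γ″ ∈ Γ_B″` over `γ_B ∈ Γ_B` and `γ‴ ∈ Γ_B‴` over the
same `γ_B`, there is an element of `Γ_B⁗` acting as `γ″` on the first component: writing
`γ″ b″ = a · b″`, the points `γ‴ b‴` and `a · b‴` of `B‴` lie over the same point `γ_B b = a · b` of `B`,
so they differ by some `k ∈ Ker(Γ_B‴ → Γ_B)`; the pair `(γ″, k γ‴)` moves `(b″, b‴)` to `a · (b″, b‴)`.
[cite: MochizukiSemiAnbd2006, Thm A.4 proof p.84] -/
theorem exists_mem_coverGroup_fst {γ : Aut c.src.A} (hγ : γ ∈ c.src.Γ) {δ : Aut P.A}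
    (hγδ : c.hom.hom ≫ δ.hom = γ.hom ≫ c.hom.hom) {γ' : Aut c'.src.A} (hγ' : γ' ∈ c'.src.Γ)
    (hγ'δ : c'.hom.hom ≫ δ.hom = γ'.hom ≫ c'.hom.hom) :
    ∃ g ∈ coverGroup c c', g.hom ≫ fstArrow c c' = fstArrow c c' ≫ γ.hom := by
  obtain ⟨a, ha⟩ := exists_ρ_eq_of_isConnectedObj c.src.A c.isStronglyConnected (pt₁ c)
    (γ.hom.hom.hom (pt₁ c))
  -- `γ‴ b‴` and `a · b‴` lie over the same point of `B`
  have hfib : (c'.hom.hom.hom.hom (γ'.hom.hom.hom (pt₂ c c')) : P.A.obj.V) =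
      c'.hom.hom.hom.hom (c'.src.A.obj.ρ a (pt₂ c c')) := by
    have e₁ := congrArg (fun φ : c'.src.A ⟶ P.A => (φ.hom.hom (pt₂ c c') : P.A.obj.V)) hγ'δ
    have e₂ := congrArg (fun φ : c.src.A ⟶ P.A => (φ.hom.hom (pt₁ c) : P.A.obj.V)) hγδ
    change (δ.hom.hom.hom (c'.hom.hom.hom.hom (pt₂ c c')) : P.A.obj.V) =
      c'.hom.hom.hom.hom (γ'.hom.hom.hom (pt₂ c c')) at e₁
    change (δ.hom.hom.hom (c.hom.hom.hom.hom (pt₁ c)) : P.A.obj.V) =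
      c.hom.hom.hom.hom (γ.hom.hom.hom (pt₁ c)) at e₂
    rw [← e₁, pt₂_spec, e₂, ← ha, hom_ρ_pt₂]
  obtain ⟨k, hk, hkpt⟩ := c'.exists_stabilizer_apply_eq hfib
  have hkΓ : k ∈ c'.src.Γ := hk.1
  let x : c.src.Γ × c'.src.Γ := (⟨γ, hγ⟩, ⟨k * γ', c'.src.Γ.mul_mem hkΓ hγ'⟩)
  have hx : pairAut c c' x ∈ BTemp.stabOrbit (amb c c') (basePt c c') :=
    pairAut_mem_stabOrbit c c' (x := x) (a := a) (by exact ha.symm) (by exact hkpt)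
  exact ⟨_, restrictOrbit_mem_coverGroup c c' x hx, restrictOrbit_fst c c' x hx⟩

/-- **Core construction, second form** (the roles of `B″` and `B‴` exchanged): an element of `Γ_B⁗`
acting as a given `γ‴ ∈ Γ_B‴` on the second component. [cite: MochizukiSemiAnbd2006, Thm A.4 proof p.84] -/
theorem exists_mem_coverGroup_snd {γ' : Aut c'.src.A} (hγ' : γ' ∈ c'.src.Γ) {δ : Aut P.A}
    (hγ'δ : c'.hom.hom ≫ δ.hom = γ'.hom ≫ c'.hom.hom) {γ : Aut c.src.A} (hγ : γ ∈ c.src.Γ)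
    (hγδ : c.hom.hom ≫ δ.hom = γ.hom ≫ c.hom.hom) :
    ∃ g ∈ coverGroup c c', g.hom ≫ sndArrow c c' = sndArrow c c' ≫ γ'.hom := by
  obtain ⟨a, ha⟩ := exists_ρ_eq_of_isConnectedObj c'.src.A c'.isStronglyConnected (pt₂ c c')
    (γ'.hom.hom.hom (pt₂ c c'))
  -- `γ″ b″` and `a · b″` lie over the same point of `B`
  have hfib : (c.hom.hom.hom.hom (γ.hom.hom.hom (pt₁ c)) : P.A.obj.V) =
      c.hom.hom.hom.hom (c.src.A.obj.ρ a (pt₁ c)) := by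
    have e₁ := congrArg (fun φ : c'.src.A ⟶ P.A => (φ.hom.hom (pt₂ c c') : P.A.obj.V)) hγ'δ
    have e₂ := congrArg (fun φ : c.src.A ⟶ P.A => (φ.hom.hom (pt₁ c) : P.A.obj.V)) hγδ
    change (δ.hom.hom.hom (c'.hom.hom.hom.hom (pt₂ c c')) : P.A.obj.V) =
      c'.hom.hom.hom.hom (γ'.hom.hom.hom (pt₂ c c')) at e₁
    change (δ.hom.hom.hom (c.hom.hom.hom.hom (pt₁ c)) : P.A.obj.V) =
      c.hom.hom.hom.hom (γ.hom.hom.hom (pt₁ c)) at e₂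
    rw [← e₂, ← pt₂_spec, e₁, ← ha, hom_ρ_pt₂]
  obtain ⟨k, hk, hkpt⟩ := c.exists_stabilizer_apply_eq hfib
  have hkΓ : k ∈ c.src.Γ := hk.1
  let x : c.src.Γ × c'.src.Γ := (⟨k * γ, c.src.Γ.mul_mem hkΓ hγ⟩, ⟨γ', hγ'⟩)
  have hx : pairAut c c' x ∈ BTemp.stabOrbit (amb c c') (basePt c c') :=
    pairAut_mem_stabOrbit c c' (x := x) (a := a) (by exact hkpt) (by exact ha.symm)
  exact ⟨_, restrictOrbit_mem_coverGroup c c' x hx, restrictOrbit_snd c c' x hx⟩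

/-! ### Lifting clauses -/

/-- **Lifting for `t`**: every `γ″ ∈ Γ_B″` is the image of an element of `Γ_B⁗`.
[cite: MochizukiSemiAnbd2006, Thm A.4 proof p.84] -/
theorem fst_lift : ∀ γ ∈ c.src.Γ, ∃ g ∈ (coverPair c c').Γ,
    (fst c c').hom ≫ γ.hom = g.hom ≫ (fst c c').hom := by
  intro γ hγ
  obtain ⟨δ, hδ, hγδ⟩ := c.hom.comm γ hγ
  obtain ⟨γ', hγ', hγ'δ⟩ := c'.isOneProper.2.1 δ hδ
  obtain ⟨g, hg, hcomm⟩ := exists_mem_coverGroup_fst c c' hγ hγδ hγ' hγ'δ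
  exact ⟨g, hg, hcomm.symm⟩

/-- **Lifting for `t′`**. [cite: MochizukiSemiAnbd2006, Thm A.4 proof p.84] -/
theorem snd_lift : ∀ γ' ∈ c'.src.Γ, ∃ g ∈ (coverPair c c').Γ,
    (snd c c').hom ≫ γ'.hom = g.hom ≫ (snd c c').hom := by
  intro γ' hγ'
  obtain ⟨δ, hδ, hγ'δ⟩ := c'.hom.comm γ' hγ'
  obtain ⟨γ, hγ, hγδ⟩ := c.isOneProper.2.1 δ hδ
  obtain ⟨g, hg, hcomm⟩ := exists_mem_coverGroup_snd c c' hγ' hγ'δ hγ hγδ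
  exact ⟨g, hg, hcomm.symm⟩

/-- **Lifting for the composite `(B⁗, Γ_B⁗) → (B, Γ_B)`**. [cite: MochizukiSemiAnbd2006, Thm A.4 proof p.84] -/
theorem comp_lift : ∀ δ ∈ P.Γ, ∃ g ∈ (coverPair c c').Γ,
    (fst c c' ≫ c.hom).hom ≫ δ.hom = g.hom ≫ (fst c c' ≫ c.hom).hom := by
  intro δ hδ
  obtain ⟨γ, hγ, hγδ⟩ := c.isOneProper.2.1 δ hδ
  obtain ⟨γ', hγ', hγ'δ⟩ := c'.isOneProper.2.1 δ hδ
  obtain ⟨g, hg, hcomm⟩ := exists_mem_coverGroup_fst c c' hγ hγδ hγ' hγ'δ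
  refine ⟨g, hg, ?_⟩
  change (fstArrow c c' ≫ c.hom.hom) ≫ δ.hom = g.hom ≫ fstArrow c c' ≫ c.hom.hom
  rw [Category.assoc, hγδ, ← Category.assoc, ← hcomm, Category.assoc]

end OneProperCover

end QDPair

end Literature.AnabelianGeometry.SemiGraphs
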